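import Summits.CriticalPhenomena.PercolationContinuityZ3.Theorems.Transplant.BoxProdZ2ConcParamsAtQ
import Summits.CriticalPhenomena.PercolationContinuityZ3.Theorems.Transplant.BoxProdZ2ConcReachRun
import HarnessLib

/-!
# (Z), part (C): the corridor obligation of the CONCRETE choice function — `reachHoldsRFn_concChoice₀ : ReachHoldsRFn concChoice₀` —
# p5-g3's `reachOblR_concGB` (the residue (C) discharged at run histories, p226xxx) instantiated at `concChoice₀` through the `AtQ`
# unpacking of `BoxProdZ2ConcParamsAtQ`

builds on p205010 (kernel theorem, internal audit signed; external expert review pending) — nothing in this file uses p205010.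
Status sentence (coordinator 2026-08-20T04:30Z): "θ(p_c) = 0 on ℤ^d, all d ≥ 2 — kernel-verified (Lean 4/Mathlib, standard axioms); internal adversarial
audit SIGNED 2026-08-20 04:29Z; external expert review pending."
Lane `prim-bschramm-*`, seat `prim-bschramm-stmt` (gen 6); helper file (`--supports stmt-CriticalPhenomena-4575`).

Constants fed (CONC-PARAMS.md §v1): `t := Conc.tc`, `R' := Conc.R'c = M + L + 1`, `Rlev := j₁ := M + L`, `j₀ := ℓ₀ := M + 1`, `N := Conc.Nc`,
`kk := Conc.kc`, `V₀ := reps X hqt`, accuracy `δ := κ.δ` (inputs at `δmin² ≤ δ²`), `η := Conc.ηc = δmin / 2 ≤ δ / 2`, `Rex := Conc.Rexc … q`,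
schedule `concRadiiGB (Conc.Cc …) (Conc.gapc … q) (fun _ => 0) (Conc.E₀c … q) (Conc.L'c … q)`.
* **`reachHoldsRFn_concChoice₀ : ReachHoldsRFn concChoice₀`.**
[cite: KozmaNitzan2024, §4 Theorem 6 (pp. 25–31), Step IV (p. 30), Lemma 12 (pp. 23–25)]
-/

noncomputable section

open MeasureTheory
open scoped Classical

namespace Summit.CriticalPhenomena.PercolationContinuityZ3.Theorems

namespace Transplant

namespace BoxProdZ2

open Literature.Probability.Percolation Literature.Probability.LatticeModels SimpleGraph KNCells KNLevels
open Literature.Barriers.CriticalPhenomena (IsQuasiTransitive IsGraphAmenable)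

/-- **The corridor obligation (C) of the concrete choice function, run form.** [cite: KozmaNitzan2024, §4 Theorem 6, Step IV (p. 30); Lemma 12 (pp. 23–25)] -/
theorem reachHoldsRFn_concChoice₀ : ReachHoldsRFn concChoice₀ := by
  intro κ W _ _ X _ hΔ hc hqt ha hinf w p hp0 hp1 hT msel M₀ q hat
  have hδA : 0 < δA X κ hΔ := δA_pos X κ hΔ
  have hη : Conc.ηc κ (δA X κ hΔ) ≤ κ.δ / 2 := by
    unfold Conc.ηc
    linarith [δmin_le_δ κ Conc.nR (δA X κ hΔ)]
  exact reachOblR_concGB X (Conc.Cc κ X hqt p hT (δA X κ hΔ) M₀) w (Conc.gapc κ X hqt w p hT (δA X κ hΔ) M₀ q) (fun _ => 0)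
    (Conc.E₀c κ X hqt w p hT (δA X κ hΔ) M₀ q) (Conc.L'c κ X hqt w p hT (δA X κ hΔ) M₀ q) q κ.δ
    (t := Conc.tc κ X hqt p hT (δA X κ hΔ) M₀) (R' := Conc.R'c κ X hqt p hT (δA X κ hΔ) M₀)
    (Rlev := M₀ + Conc.Lc κ X hqt p hT (δA X κ hΔ) M₀) (N := Conc.Nc κ X hqt p hT (δA X κ hΔ) M₀) (j₀ := M₀ + 1)
    (j₁ := M₀ + Conc.Lc κ X hqt p hT (δA X κ hΔ) M₀) (ℓ₀ := M₀ + 1)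
    Conc.hr Conc.hR100 Conc.hRl le_rfl Conc.hℓ₀ hΔ hT (reps X hqt) (frame_reps X hqt) κ.hδ0 (Conc.hmsel_at hat)
    (Conc.hstd_at hat (δmin_le_δ κ Conc.nR (δA X κ hΔ))) (Nat.lt_succ_self _)
    (Conc.hlink_at hat (δmin_le_δ κ Conc.nR (δA X κ hΔ))) Conc.ψ_le_E₀ Conc.hL_reach Conc.L'_le_E₀ le_rfl
    (Conc.kc κ X hqt p hT (δA X κ hΔ) M₀) (Conc.hN_at hδA hp0 hp1) (Conc.hk_at hat hp0 hp1 (δmin_le_δ κ Conc.nR (δA X κ hΔ)))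
    (Conc.hcount_Icc_at hat hp0 hp1 (δmin_le_δ κ Conc.nR (δA X κ hΔ))) hη Conc.hgapL (Conc.hRex_at hat le_rfl) Conc.hsch

/-- Hence the corridor obligation in the chosen-edge-free bookkeeping of `ConcChoice.ReachHoldsR` at every admissible instance. [folklore] -/
theorem reachHoldsR_concChoice₀ (κ : ConcConsts) {W : Type} [DecidableEq W] [Countable W] (X : SimpleGraph W) [X.LocallyFinite]
    (hΔ : ∀ v, X.degree v ≤ κ.Δ) (hc : X.Connected) (hqt : IsQuasiTransitive X) (ha : IsGraphAmenable X) (hinf : Infinite W) (w : W)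
    (p : unitInterval) (hp0 : 0 < (p : ℝ)) (hp1 : (p : ℝ) < 1) (hT : TubeSubcritical X p) :
    (concChoice₀ κ X hΔ hc hqt ha hinf w p hp0 hp1 hT).ReachHoldsR :=
  reachHoldsRFn_concChoice₀ κ X hΔ hc hqt ha hinf w p hp0 hp1 hT

end BoxProdZ2

end Transplant

end Summit.CriticalPhenomena.PercolationContinuityZ3.Theorems

end
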